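import Mathlib
import HarnessLib

/-!
# Kollár–Szabó going down: the exceptional ideal `(t)R₁` is stable under automorphisms preserving `S` and `𝔪_S`
# (crux `WildQuotients.WildQuotientResolution`, stub `stub_phaseZeroHighDim`)

Crux stmt-ResolutionOfSingularities-15640 (`WildQuotientResolution`), registered stub `stub_phaseZeroHighDim`; programme:
`KollarSzaboGoingDown_holds` via ✓`kollarSzaboGoingDown_of_localStepLE` and ✓`localStep_package_ofPrime` (hypothesis `hstab`).
For the quadratic transform `R₁ ⊇ S[𝔪/t] ⊇ S` inside `K`: `𝔪_S R₁ = t R₁` (every generator `x_j = t · (x_j/t)`), so any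
automorphism `σ` of `K` with `σ(R₁) ⊆ R₁`, `σ(S) ⊆ S` and `σ` residue-trivial on `S` (hence `σ(𝔪_S) ⊆ 𝔪_S`) maps `t` into
`t R₁` and therefore stabilises the exceptional ideal `(t) R₁`:

* `sigma_mem_maximalIdeal_of_residueTrivial` — residue-trivial `σ` preserves `𝔪_S`;
* `mem_span_singleton_of_mem_span_range` — `𝔪_S ⊆ t R₁` when `𝔪_S = (x_1, …, x_d)`, `t = x_i`, `x_j/x_i ∈ R₁`;
* ★ `span_singleton_stable` — `σ ((t)R₁) ⊆ (t)R₁` (the `hstab` hypothesis of ✓`localStep_package_ofPrime`, for the restricted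
  action of ✓`EigenlineChart.exists_restrict_ringAut`).

[OURS · crux stmt-ResolutionOfSingularities-15640 · helper toward `stub_phaseZeroHighDim` (glue; NOT a proof of the stub); counted 0; AI-level
work, weaker than expert review.] [folklore]
-/

-- single-problem summit: the doubled namespace component `ResolutionOfSingularities` is forced
set_option linter.dupNamespace false

noncomputable section

open IsLocalRing

namespace Summit.ResolutionOfSingularities.ResolutionOfSingularities.Theorems.WildQuotientResolution.KSGoingDown

universe u

variable {K : Type u} [Field K] {S R₁ : Subring K} [IsLocalRing S] (hSR : S ≤ R₁)
  (σ : K ≃+* K) (hσS : ∀ s ∈ S, σ s ∈ S) (hσR : ∀ z ∈ R₁, σ z ∈ R₁)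

include hσS in
/-- A residue-trivial automorphism (`σ s ≡ s mod 𝔪_S`) preserves `𝔪_S`. [folklore] -/
theorem sigma_mem_maximalIdeal_of_residueTrivial
    (hres : ∀ s : S, (⟨σ s, hσS s s.2⟩ : S) - s ∈ maximalIdeal S) {s : S} (hs : s ∈ maximalIdeal S) :
    (⟨σ s, hσS s s.2⟩ : S) ∈ maximalIdeal S := by
  have h := (maximalIdeal S).add_mem (hres s) hs
  rwa [sub_add_cancel] at h

include hSR in
omit [IsLocalRing S] in
/-- If `𝔪_S = (x_1, …, x_d)`, `t = x_i` and all `x_j / t ∈ R₁ ⊇ S`, then every element of `𝔪_S` lies in `t R₁`. [folklore] -/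
theorem mem_span_singleton_of_mem_span_range {d : ℕ} (x : Fin d → S) (i : Fin d)
    (hfrac : ∀ j : Fin d, ((x j : S) : K) / ((x i : S) : K) ∈ R₁) (hxi : ((x i : S) : K) ≠ 0)
    {s : S} (hs : s ∈ Ideal.span (Set.range x)) :
    (⟨(s : K), hSR s.2⟩ : R₁) ∈ Ideal.span {(⟨((x i : S) : K), hSR (x i).2⟩ : R₁)} := by
  induction hs using Submodule.span_induction with
  | mem y hy =>
    obtain ⟨j, rfl⟩ := hy
    refine Ideal.mem_span_singleton.mpr ⟨⟨_, hfrac j⟩, Subtype.ext ?_⟩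
    change ((x j : S) : K) = ((x i : S) : K) * (((x j : S) : K) / ((x i : S) : K))
    rw [mul_div_cancel₀ _ hxi]
  | zero => exact (Ideal.span _).zero_mem
  | add y z _ _ hy hz =>
    have : (⟨((y + z : S) : K), hSR (y + z).2⟩ : R₁) = ⟨(y : K), hSR y.2⟩ + ⟨(z : K), hSR z.2⟩ := Subtype.ext rfl
    rw [this]
    exact Ideal.add_mem _ hy hz
  | smul a y _ hy =>
    have : (⟨((a • y : S) : K), hSR (a • y).2⟩ : R₁) = ⟨(a : K), hSR a.2⟩ * ⟨(y : K), hSR y.2⟩ := Subtype.ext rfl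
    rw [this]
    exact Ideal.mul_mem_left _ _ hy

include hSR hσS hσR in
/-- ★ **The exceptional ideal `(t)R₁` is `σ`-stable**: for `σ` preserving `S` and `R₁`, residue-trivial on `S`, with `𝔪_S = (x)`,
`t = x_i ≠ 0`, `x_j/x_i ∈ R₁`: `σ (t R₁) ⊆ t R₁`. [folklore] -/
theorem span_singleton_stable (hres : ∀ s : S, (⟨σ s, hσS s s.2⟩ : S) - s ∈ maximalIdeal S)
    {d : ℕ} (x : Fin d → S) (hx : Ideal.span (Set.range x) = maximalIdeal S) (i : Fin d)
    (hfrac : ∀ j : Fin d, ((x j : S) : K) / ((x i : S) : K) ∈ R₁) (hxi : ((x i : S) : K) ≠ 0) :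
    ∀ r ∈ Ideal.span {(⟨((x i : S) : K), hSR (x i).2⟩ : R₁)},
      (⟨σ r, hσR r r.2⟩ : R₁) ∈ Ideal.span {(⟨((x i : S) : K), hSR (x i).2⟩ : R₁)} := by
  intro r hr
  obtain ⟨c, rfl⟩ := Ideal.mem_span_singleton.mp hr
  -- `σ (t c) = σ t · σ c` with `σ t ∈ 𝔪_S ⊆ t R₁`
  have hxim : x i ∈ maximalIdeal S := hx ▸ Ideal.subset_span ⟨i, rfl⟩
  have hσt : (⟨σ ((x i : S) : K), hσS _ (x i).2⟩ : S) ∈ Ideal.span (Set.range x) := by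
    rw [hx]
    exact sigma_mem_maximalIdeal_of_residueTrivial σ hσS hres hxim
  have hσt' := mem_span_singleton_of_mem_span_range hSR x i hfrac hxi hσt
  have heq : (⟨σ (((⟨((x i : S) : K), hSR (x i).2⟩ : R₁) * c : R₁) : K), hσR _ ((⟨((x i : S) : K), hSR (x i).2⟩ : R₁) * c).2⟩ : R₁) =
      (⟨σ ((x i : S) : K), hSR (hσS _ (x i).2)⟩ : R₁) * ⟨σ (c : K), hσR _ c.2⟩ := by
    apply Subtype.ext
    change σ (((x i : S) : K) * (c : K)) = σ ((x i : S) : K) * σ (c : K)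
    rw [map_mul]
  rw [heq]
  exact Ideal.mul_mem_right _ _ hσt'

end Summit.ResolutionOfSingularities.ResolutionOfSingularities.Theorems.WildQuotientResolution.KSGoingDown

end
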